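import Literature.AlgebraicGeometry.FundamentalGroup.RiemannExistenceCharPolyRegular
import HarnessLib

/-!
# Riemann's existence theorem: the characteristic polynomial of an integral continuous function

Topic `Literature/AlgebraicGeometry/FundamentalGroup`; proof file continuing
`RiemannExistenceCharPoly.lean` (Theorem A: a finite covering `q : T → X(ℂ)` whose sheets are
separated by continuous functions with REGULAR characteristic polynomials is finite étale algebraic)
and `RiemannExistenceCharPolyRegular.lean` (a continuous function on `U(ℂ)` that is a pointwise
root of a monic regular polynomial is regular, `X` normal). Here the two are combined into:

* `CharPolyIntegral.exists_charPoly` — **Theorem B.** Let `X` be an integral scheme, separated and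
  locally of finite type over `ℂ`, `U ⊆ X` a non-empty affine open with `Γ(X, U)` integrally
  closed, `q : T → X(ℂ)` a covering map with finite fibres, and `h : T → ℂ` continuous on
  `q⁻¹(U(ℂ))` and INTEGRAL over `Γ(X, U)`: `R(q t)(h t) = 0` on `q⁻¹(U(ℂ))` for one monic
  `R ∈ Γ(X, U)[τ]`. Then the fibrewise characteristic polynomial of `h` is regular: there is a
  monic `Q ∈ Γ(X, U)[τ]` whose complex roots over every `P ∈ U(ℂ)`, with multiplicity, are the
  values of `h` on `q⁻¹(P)`.

Proof. The fibre cardinality `d` of `q` is constant on `X(ℂ)` (it is locally constant, and a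
clopen subset of `X(ℂ)` is `W(ℂ)` for a clopen `W ⊆ X` — SGA1 XII Cor. 2.6,
`ComplexPoints.exists_isClopen_setOf_pt_mem_eq` — with `X` irreducible;
`card_fibre_eq`). The coefficients `c_j(P)` of `χ_P(τ) = ∏_{t ∈ q⁻¹(P)} (τ - h(t))` are
continuous on `U(ℂ)` (locally the fibres of the covering `q` are enumerated by continuous sheets,
`exists_local_sheets`; `continuousOn_coeff_charPoly`), and they are pointwise roots of ONE monic
`S_j ∈ Γ(X, U)[τ]` each (`exists_monic_eval_coeff_eq_zero`: in the ring of all functions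
`U(ℂ) → ℂ`, an algebra over `Γ(X, U)` by evaluation, the sheet values `Y_1, …, Y_d` of `h` in any
enumeration of the fibres are roots of `R`, hence integral, and `c_j = ± e_{d-j}(Y_1, …, Y_d)` lies
in the integral closure). By `CharPolyRegular.exists_eval_eq_of_continuousOn_of_root` each `c_j` is
a regular function `b_j ∈ Γ(X, U)`, and `Q = Σ b_j τ^j` (`exists_monic_map_eq_prod`; `Q` is monic
because `Γ(X, U) → (U(ℂ) → ℂ)` is injective, `X` being reduced and Jacobson).

* `riemannExistence_qbarDescent_of_finiteIndex_of_integralSeparating` (in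
  `RiemannExistenceQbarDescentProofs.lean`, sequel) then reduces the `ℚ̄`-descent form of Riemann's
  existence theorem to the EXISTENCE, for every finite covering `T → S(ℂ)` of a smooth irreducible
  affine `S` and every `P₀ ∈ S(ℂ)`, of a continuous function on `T`, integral over `Γ(S, 𝒪_S)`,
  separating the points of the fibre over `P₀` — the transcendental heart of SGA1 XII Thm. 5.1
  (Grauert–Remmert, or GAGA in the projective case, or Hörmander's `L²` estimates).

## References

* [SGA1] A. Grothendieck, M. Raynaud, *Revêtements étales et groupe fondamental (SGA 1)*, LNM 224 /
  arXiv:math/0206203: Exp. XII Cor. 2.6, Thm. 5.1 (p. 333) and its proof, part 2.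
* J.-P. Serre, *Géométrie algébrique et géométrie analytique*, Ann. Inst. Fourier 6 (1956), §2
  n° 7 Prop. 5. [SerreGAGA1956]
* O. Forster, *Lectures on Riemann Surfaces*, GTM 81, Springer 1981, §8 «Algebraic Functions»
  (the elementary symmetric functions of a holomorphic/meromorphic function on the sheets of a
  finite covering are holomorphic/meromorphic on the base; algebraic functions) — the
  one-dimensional model of Theorem B. [Forster1981]

#harness_tags algebraic_geometry.etale, algebraic_geometry.sga1, complex_geometry.riemann_existence
-/

noncomputable section

open CategoryTheory AlgebraicGeometry Polynomial
open _root_.Topology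

namespace Literature.AlgebraicGeometry.FundamentalGroup

open Literature.AlgebraicGeometry.Motives Literature.AlgebraicGeometry.Motives.AlgPoints

namespace CharPolyIntegral

/-! ### Algebra: coefficients of `∏ₖ (τ - Yₖ)` in a function ring -/

section Algebra

/-- Mapping a product of linear factors along a ring homomorphism. [folklore] -/
theorem map_prod_X_sub_C {R S : Type*} [CommRing R] [CommRing S] (f : R →+* S) (s : Multiset R) :
    ((s.map fun a ↦ X - C a).prod).map f = ((s.map f).map fun a ↦ X - C a).prod := by
  rw [Polynomial.map_multiset_prod, Multiset.map_map, Multiset.map_map]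
  congr 1
  refine Multiset.map_congr rfl fun a _ ↦ ?_
  simp

variable {A : Type*} [CommRing A] {ι : Type*} (φ : ι → A →+* ℂ)

/-- Evaluation at `i` after the diagonal map `A → (ι → ℂ)` is `φ i`. [folklore] -/
theorem evalRingHom_comp_pi (i : ι) :
    (Pi.evalRingHom (fun _ : ι ↦ ℂ) i).comp (RingHom.pi φ) = φ i :=
  RingHom.ext fun _ ↦ rfl

/-- **The coefficients of `∏ₖ (τ - Yₖ)` are uniformly integral.** Let `A → (ι → ℂ)`, `a ↦ (φᵢ a)ᵢ`,
make the ring of functions `ι → ℂ` an `A`-algebra, and let `Y₁, …, Y_d : ι → ℂ` be pointwise roots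
of one monic `R ∈ A[τ]`. Then for each `j` there is a monic `S ∈ A[τ]` with
`S(φᵢ)(c_j(i)) = 0` for all `i`, where `c_j(i)` is the `j`-th coefficient of `∏ₖ (τ - Yₖ(i))`:
the `Yₖ` are integral over `A`, so the coefficients of `∏ₖ (τ - Yₖ) ∈ (ι → ℂ)[τ]` lie in the
integral closure of `A` (Mathlib `integralClosure`). [cite: Forster1981, §8 (model)] [folklore] -/
theorem exists_monic_eval_coeff_eq_zero {d : ℕ} (Y : Fin d → ι → ℂ) (R : A[X]) (hR : R.Monic)
    (hY : ∀ k i, (R.map (φ i)).eval (Y k i) = 0) (j : ℕ) :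
    ∃ S : A[X], S.Monic ∧ ∀ i, (S.map (φ i)).eval
      ((((Finset.univ : Finset (Fin d)).val.map fun k ↦ Y k i).map fun a ↦ X - C a).prod.coeff j)
        = 0 := by
  classical
  letI : Algebra A (ι → ℂ) := (RingHom.pi φ).toAlgebra
  have halg : algebraMap A (ι → ℂ) = RingHom.pi φ := rfl
  -- each sheet function is integral
  have hYint : ∀ k, IsIntegral A (Y k) := by
    intro k
    refine ⟨R, hR, funext fun i ↦ ?_⟩
    have h1 := Polynomial.hom_eval₂ R (algebraMap A (ι → ℂ)) (Pi.evalRingHom (fun _ : ι ↦ ℂ) i) (Y k)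
    rw [halg, evalRingHom_comp_pi] at h1
    rw [halg]
    change (Pi.evalRingHom (fun _ : ι ↦ ℂ) i) (eval₂ (RingHom.pi φ) (Y k) R) = 0
    rw [h1, ← Polynomial.eval_map]
    exact hY k i
  -- the characteristic polynomial over the integral closure
  let A' := integralClosure A (ι → ℂ)
  let Y' : Fin d → A' := fun k ↦ ⟨Y k, hYint k⟩
  let χ' : A'[X] := (((Finset.univ : Finset (Fin d)).val.map Y').map fun a ↦ X - C a).prod
  let χ : (ι → ℂ)[X] := (((Finset.univ : Finset (Fin d)).val.map Y).map fun a ↦ X - C a).prod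
  have hχ : χ'.map (algebraMap A' (ι → ℂ)) = χ := by
    change χ'.map (A'.val.toRingHom) = χ
    rw [map_prod_X_sub_C, Multiset.map_map (⇑A'.val.toRingHom) Y']
    rfl
  have hint : IsIntegral A (χ.coeff j) := by
    rw [← hχ, Polynomial.coeff_map]
    exact (χ'.coeff j).2
  obtain ⟨S, hS, hS0⟩ := hint
  refine ⟨S, hS, fun i ↦ ?_⟩
  have h1 := Polynomial.hom_eval₂ S (algebraMap A (ι → ℂ)) (Pi.evalRingHom (fun _ : ι ↦ ℂ) i)
    (χ.coeff j)
  rw [hS0, map_zero, halg, evalRingHom_comp_pi, ← Polynomial.eval_map] at h1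
  have h2 : (Pi.evalRingHom (fun _ : ι ↦ ℂ) i) (χ.coeff j) =
      ((((Finset.univ : Finset (Fin d)).val.map fun k ↦ Y k i).map fun a ↦ X - C a).prod.coeff j) := by
    rw [← Polynomial.coeff_map, map_prod_X_sub_C,
      Multiset.map_map (⇑(Pi.evalRingHom (fun _ : ι ↦ ℂ) i)) Y]
    rfl
  rw [h2] at h1
  exact h1.symm

/-- **From regular coefficients to the characteristic polynomial.** If `A → (ι → ℂ)` is injective
and `b_j ∈ A` has values `φᵢ(b_j) = c_j(i)`, the `j`-th coefficient of `∏ₖ (τ - Yₖ(i))`, for all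
`i` and `j`, then `Q = Σ_{j ≤ d} b_j τ^j ∈ A[τ]` is monic and `Q(φᵢ) = ∏ₖ (τ - Yₖ(i))` for every `i`.
[folklore] -/
theorem exists_monic_map_eq_prod (hφ : Function.Injective (RingHom.pi φ)) {d : ℕ}
    (Y : Fin d → ι → ℂ) (b : ℕ → A)
    (hb : ∀ j i, φ i (b j) =
      (((Finset.univ : Finset (Fin d)).val.map fun k ↦ Y k i).map fun a ↦ X - C a).prod.coeff j) :
    ∃ Q : A[X], Q.Monic ∧ ∀ i, Q.map (φ i) =
      ((((Finset.univ : Finset (Fin d)).val.map fun k ↦ Y k i).map fun a ↦ X - C a).prod) := by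
  classical
  let χ : (ι → ℂ)[X] := (((Finset.univ : Finset (Fin d)).val.map Y).map fun a ↦ X - C a).prod
  have hχi : ∀ i, χ.map (Pi.evalRingHom (fun _ : ι ↦ ℂ) i) =
      (((Finset.univ : Finset (Fin d)).val.map fun k ↦ Y k i).map fun a ↦ X - C a).prod := by
    intro i
    change ((((Finset.univ : Finset (Fin d)).val.map Y).map fun a ↦ X - C a).prod).map _ = _
    rw [map_prod_X_sub_C, Multiset.map_map (⇑(Pi.evalRingHom (fun _ : ι ↦ ℂ) i)) Y]
    rfl
  have hχm : χ.Monic :=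
    monic_multiset_prod_of_monic _ _ fun a _ ↦ monic_X_sub_C a
  have hχd : χ.natDegree ≤ d := by
    nontriviality (ι → ℂ)
    have h1 := natDegree_multiset_prod_X_sub_C_eq_card (((Finset.univ : Finset (Fin d)).val.map Y))
    rw [Multiset.card_map, Finset.card_val, Finset.card_univ, Fintype.card_fin] at h1
    exact h1.le
  let Q : A[X] := ∑ j ∈ Finset.range (d + 1), monomial j (b j)
  have hQc : ∀ n, Q.coeff n = if n ∈ Finset.range (d + 1) then b n else 0 := by
    intro n
    simp only [Q, finsetSum_coeff, coeff_monomial]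
    rw [Finset.sum_ite_eq']
  have hQ : Q.map (RingHom.pi φ) = χ := by
    ext n : 1
    rw [coeff_map, hQc]
    split_ifs with hn
    · funext i
      change φ i (b n) = χ.coeff n i
      rw [hb]
      change _ = (Pi.evalRingHom (fun _ : ι ↦ ℂ) i) (χ.coeff n)
      rw [← coeff_map, hχi]
    · rw [map_zero]
      rw [Finset.mem_range, not_lt] at hn
      exact (coeff_eq_zero_of_natDegree_lt (lt_of_le_of_lt hχd hn)).symm
  refine ⟨Q, monic_of_injective hφ (by rw [hQ]; exact hχm), fun i ↦ ?_⟩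
  rw [← hχi, ← hQ, Polynomial.map_map, evalRingHom_comp_pi]

end Algebra

/-! ### Topology: local sheets of a finite covering; continuity of the coefficients -/

section Covering

variable {T B : Type*} [TopologicalSpace T] [TopologicalSpace B] {q : T → B}

/-- **Local sheets of a finite covering.** Every point `P₁` of the base of a covering map `q` with
finite fibres has an open neighbourhood `W` over which the fibres of `q` are enumerated by finitely
many continuous sections `sec₁, …, sec_d : W → T` (read off from a local trivialisation).
[folklore] -/
theorem exists_local_sheets (hq : IsCoveringMap q) (hfin : ∀ P, (q ⁻¹' {P}).Finite) (P₁ : B) :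
    ∃ (W : Set B) (d : ℕ) (sec : Fin d → B → T), P₁ ∈ W ∧ IsOpen W ∧
      (∀ k, ContinuousOn (sec k) W) ∧ (∀ k, ∀ P ∈ W, q (sec k P) = P) ∧
      ∀ P ∈ W, (hfin P).toFinset.val = (Finset.univ : Finset (Fin d)).val.map fun k ↦ sec k P := by
  classical
  obtain ⟨_, W, hP₁W, hWo, hqWo, H, hH⟩ := hq P₁
  -- enumerate the fibre over `P₁`
  set F := (hfin P₁).toFinset with hF
  let d := F.card
  let e : Fin d ≃ ↥(q ⁻¹' {P₁}) :=
    (F.equivFin.symm).trans (Equiv.subtypeEquivRight (fun t ↦ by rw [hF, Set.Finite.mem_toFinset]))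
  -- the sheets
  let sec : Fin d → B → T := fun k P ↦
    if hP : P ∈ W then (H.symm (⟨P, hP⟩, e k)).1 else (e k).1
  have hsecW : ∀ k, ∀ P (hP : P ∈ W), sec k P = (H.symm (⟨P, hP⟩, e k)).1 := fun k P hP ↦ dif_pos hP
  have hqsec : ∀ k, ∀ P ∈ W, q (sec k P) = P := by
    intro k P hP
    rw [hsecW k P hP, ← hH, Homeomorph.apply_symm_apply]
  refine ⟨W, d, sec, hP₁W, hWo, fun k ↦ ?_, hqsec, fun P hP ↦ ?_⟩
  · rw [continuousOn_iff_continuous_restrict]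
    have h1 : W.restrict (sec k) = fun P : W ↦ (H.symm (P, e k)).1 := by
      funext P
      exact hsecW k P.1 P.2
    rw [h1]
    exact continuous_subtype_val.comp (H.symm.continuous.comp (Continuous.prodMk_left (e k)))
  · -- the fibre over `P ∈ W` is `{sec k P | k}`
    have hinj : Function.Injective fun k ↦ sec k P := by
      intro k k' hkk'
      have h1 : H.symm (⟨P, hP⟩, e k) = H.symm (⟨P, hP⟩, e k') := by
        apply Subtype.ext
        have h2 := hkk'
        simp only [hsecW _ P hP] at h2
        exact h2
      exact e.injective (Prod.ext_iff.mp (H.symm.injective h1)).2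
    have hF' : (hfin P).toFinset = Finset.univ.map ⟨fun k ↦ sec k P, hinj⟩ := by
      ext t
      simp only [Set.Finite.mem_toFinset, Set.mem_preimage, Set.mem_singleton_iff, Finset.mem_map,
        Finset.mem_univ, true_and, Function.Embedding.coeFn_mk]
      constructor
      · intro ht
        have htW : t ∈ q ⁻¹' W := by rw [Set.mem_preimage, ht]; exact hP
        refine ⟨e.symm (H ⟨t, htW⟩).2, ?_⟩
        rw [hsecW _ P hP, Equiv.apply_symm_apply]
        have h3 : (H ⟨t, htW⟩).1 = ⟨P, hP⟩ := Subtype.ext (by rw [hH]; exact ht)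
        rw [← h3, Prod.mk.eta, Homeomorph.symm_apply_apply]
      · rintro ⟨k, rfl⟩
        exact hqsec k P hP
    rw [hF', Finset.map_val]
    rfl

/-- The coefficients of `∏_{k ∈ s} (τ - z_k(P))` are continuous in `P` when the `z_k` are
(induction on `s`: `((τ - c) p)_j = p_{j-1} - c p_j`). [folklore] -/
theorem continuousOn_coeff_prod_X_sub_C {ι : Type*} (s : Finset ι) (z : ι → B → ℂ) {E : Set B}
    (hz : ∀ k ∈ s, ContinuousOn (z k) E) (j : ℕ) :
    ContinuousOn (fun P ↦ (∏ k ∈ s, (X - C (z k P))).coeff j) E := by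
  classical
  induction s using Finset.induction_on generalizing j with
  | empty =>
    simp only [Finset.prod_empty]
    exact continuousOn_const
  | insert a s ha ih =>
    have hz' : ∀ k ∈ s, ContinuousOn (z k) E := fun k hk ↦ hz k (Finset.mem_insert_of_mem hk)
    have hza : ContinuousOn (z a) E := hz a (Finset.mem_insert_self a s)
    simp only [Finset.prod_insert ha]
    have heq : ∀ P, ((X - C (z a P)) * ∏ k ∈ s, (X - C (z k P))).coeff j =
        (if j = 0 then 0 else (∏ k ∈ s, (X - C (z k P))).coeff (j - 1)) -
          z a P * (∏ k ∈ s, (X - C (z k P))).coeff j := by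
      intro P
      rw [sub_mul, coeff_sub, coeff_C_mul]
      congr 1
      cases j with
      | zero => simp
      | succ n => simp [coeff_X_mul]
    simp_rw [heq]
    refine ContinuousOn.sub ?_ (hza.mul (ih hz' j))
    split_ifs
    · exact continuousOn_const
    · exact ih hz' (j - 1)

/-- **The coefficients of the fibrewise characteristic polynomial `χ_P(τ) = ∏_{t ∈ q⁻¹(P)} (τ - h t)`
of a function `h` continuous on `q⁻¹(s)` along a finite covering `q` are continuous on `s`**
(locally the fibres are enumerated by continuous sheets, `exists_local_sheets`).
[cite: Forster1981, §8 (model)] [folklore] -/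
theorem continuousOn_coeff_charPoly (hq : IsCoveringMap q) (hfin : ∀ P, (q ⁻¹' {P}).Finite)
    {s : Set B} (h : T → ℂ) (hh : ContinuousOn h (q ⁻¹' s)) (j : ℕ) :
    ContinuousOn (fun P ↦ ((((hfin P).toFinset.val).map h).map fun a ↦ X - C a).prod.coeff j) s := by
  intro P₁ hP₁
  obtain ⟨W, d, sec, hP₁W, hWo, hsecc, hqsec, hfib⟩ := exists_local_sheets hq hfin P₁
  -- on `W ∩ s` the function is a coefficient of `∏ₖ (X - C (h (sec k P)))`
  have hz : ∀ k ∈ (Finset.univ : Finset (Fin d)), ContinuousOn (fun P ↦ h (sec k P)) (W ∩ s) := by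
    intro k _
    refine hh.comp ((hsecc k).mono Set.inter_subset_left) fun P hP ↦ ?_
    rw [Set.mem_preimage, hqsec k P hP.1]
    exact hP.2
  have hc := continuousOn_coeff_prod_X_sub_C Finset.univ (fun k P ↦ h (sec k P)) hz j
  have heqOn : Set.EqOn (fun P ↦ ((((hfin P).toFinset.val).map h).map fun a ↦ X - C a).prod.coeff j)
      (fun P ↦ (∏ k ∈ (Finset.univ : Finset (Fin d)), (X - C (h (sec k P)))).coeff j) (W ∩ s) := by
    intro P hP
    simp only
    rw [hfib P hP.1, Multiset.map_map, Multiset.map_map, Finset.prod_eq_multiset_prod]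
    rfl
  have h2 : ContinuousWithinAt
      (fun P ↦ ((((hfin P).toFinset.val).map h).map fun a ↦ X - C a).prod.coeff j) (W ∩ s) P₁ :=
    (hc.congr heqOn) P₁ ⟨hP₁W, hP₁⟩
  rwa [Set.inter_comm, continuousWithinAt_inter (hWo.mem_nhds hP₁W)] at h2

/-- **The fibre cardinality of a finite covering is locally constant.** [folklore] -/
theorem isLocallyConstant_card_fibre (hq : IsCoveringMap q) (hfin : ∀ P, (q ⁻¹' {P}).Finite) :
    IsLocallyConstant fun P ↦ (hfin P).toFinset.card := by
  refine (IsLocallyConstant.iff_exists_open _).mpr fun P₁ ↦ ?_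
  obtain ⟨W, d, sec, hP₁W, hWo, -, -, hfib⟩ := exists_local_sheets hq hfin P₁
  have hcard : ∀ P ∈ W, (hfin P).toFinset.card = d := by
    intro P hP
    rw [← Finset.card_val, hfib P hP, Multiset.card_map, Finset.card_val, Finset.card_univ,
      Fintype.card_fin]
  exact ⟨W, hWo, hP₁W, fun P hP ↦ by rw [hcard P hP, hcard P₁ hP₁W]⟩

end Covering

/-! ### Complex points: constancy of the fibre cardinality over a connected scheme -/

section Points

variable {X : SchemeOver ℂ} [LocallyOfFiniteType X.hom] [PreconnectedSpace X.left]
  {T : Type*} [TopologicalSpace T] {q : T → ComplexPoints X}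

/-- **The fibre cardinality of a finite covering of `X(ℂ)`, `X` connected and locally of finite type
over `ℂ`, is constant**: it is locally constant, and a clopen subset of `X(ℂ)` is `W(ℂ)` for a
clopen `W ⊆ X` (SGA1 XII Cor. 2.6, `ComplexPoints.exists_isClopen_setOf_pt_mem_eq`), i.e. `∅` or
`X(ℂ)`. [cite: SGA1, Exp. XII Cor. 2.6 and Prop. 2.4] -/
theorem card_fibre_eq (hq : IsCoveringMap q) (hfin : ∀ P, (q ⁻¹' {P}).Finite)
    (P P' : ComplexPoints X) : (hfin P).toFinset.card = (hfin P').toFinset.card := by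
  have hlc := isLocallyConstant_card_fibre hq hfin
  set C := (fun P ↦ (hfin P).toFinset.card) ⁻¹' {(hfin P').toFinset.card} with hC
  have hCc : IsClopen C := hlc.isClopen_fiber _
  obtain ⟨W, hW, hWC⟩ := ComplexPoints.exists_isClopen_setOf_pt_mem_eq (X := X) hCc
  have hP'C : P' ∈ C := rfl
  rcases isClopen_iff.mp hW with hWe | hWu
  · rw [← hWC, hWe] at hP'C
    exact (Set.notMem_empty _ hP'C).elim
  · have hPC : P ∈ C := by
      rw [← hWC, hWu]
      exact Set.mem_univ _
    exact hPC

end Points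

/-! ### Theorem B -/

section Main

variable {X : SchemeOver ℂ} [IsSeparated X.hom] [LocallyOfFiniteType X.hom] [IsIntegral X.left]

/-- **Theorem B: the characteristic polynomial of an integral continuous function along a finite
covering is regular.** `X` integral, separated and locally of finite type over `ℂ`; `U ⊆ X` a
non-empty affine open with `Γ(X, U)` integrally closed; `q : T → X(ℂ)` a covering map with finite
fibres; `h : T → ℂ` continuous on `q⁻¹(U(ℂ))` with `R(q t)(h t) = 0` there for one monic
`R ∈ Γ(X, U)[τ]`. Then there is a monic `Q ∈ Γ(X, U)[τ]` with
`roots Q(P) = {h t | t ∈ q⁻¹(P)}` (multisets) for every `P ∈ U(ℂ)`. See the module docstring for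
the proof. [cite: SGA1, Exp. XII Thm. 5.1 (p. 333), proof, part 2]
[cite: Forster1981, §8 (one-dimensional model)] -/
theorem exists_charPoly {U : X.left.Opens} (hU : IsAffineOpen U) (hUne : (U : Set X.left).Nonempty)
    (hA : IsIntegrallyClosed Γ(X.left, U)) {T : Type*} [TopologicalSpace T]
    {q : T → ComplexPoints X} (hq : IsCoveringMap q) (hfin : ∀ P, (q ⁻¹' {P}).Finite)
    (h : T → ℂ) (hh : ContinuousOn h (q ⁻¹' {P | P.pt ∈ U})) (R : Γ(X.left, U)[X]) (hR : R.Monic)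
    (hroot : ∀ (t : T) (ht : (q t).pt ∈ U), (R.map ((q t).evalRingHom U ht)).eval (h t) = 0) :
    ∃ Q : Γ(X.left, U)[X], Q.Monic ∧ ∀ (P : ComplexPoints X) (hP : P.pt ∈ U),
      (Q.map (P.evalRingHom U hP)).roots = ((hfin P).toFinset.val).map h := by
  classical
  -- the index set `ι = U(ℂ)` and the evaluation maps
  let ι := ↥{P : ComplexPoints X | P.pt ∈ U}
  let φ : ι → Γ(X.left, U) →+* ℂ := fun i ↦ i.1.evalRingHom U i.2
  have hφ : Function.Injective (RingHom.pi φ) := by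
    refine (injective_iff_map_eq_zero _).mpr fun a ha ↦ ?_
    exact CharPolyRegular.eq_zero_of_forall_eval_eq_zero a fun P hP ↦ congrFun ha ⟨P, hP⟩
  rcases isEmpty_or_nonempty ι with hι | ⟨⟨P₀⟩⟩
  · exact ⟨1, monic_one, fun P hP ↦ (hι.false ⟨P, hP⟩).elim⟩
  -- fibre cardinality `d` and enumerations of the fibres
  haveI : PreconnectedSpace X.left := inferInstance
  set d := (hfin P₀.1).toFinset.card with hd
  have hcard : ∀ P : ComplexPoints X, (hfin P).toFinset.card = d :=
    fun P ↦ card_fibre_eq hq hfin P P₀.1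
  let en : ∀ P : ComplexPoints X, Fin d ≃ ↥(hfin P).toFinset :=
    fun P ↦ ((hfin P).toFinset.equivFinOfCardEq (hcard P)).symm
  let Y : Fin d → ι → ℂ := fun k i ↦ h (en i.1 k).1
  have hYM : ∀ i : ι, (Finset.univ : Finset (Fin d)).val.map (fun k ↦ Y k i) =
      ((hfin i.1).toFinset.val).map h := by
    intro i
    calc (Finset.univ : Finset (Fin d)).val.map (fun k ↦ Y k i)
        = ((Finset.univ : Finset (Fin d)).map (en i.1).toEmbedding).val.map fun t ↦ h t.1 := by
          rw [Finset.map_val, Multiset.map_map]; rfl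
      _ = (Finset.univ : Finset ↥(hfin i.1).toFinset).val.map fun t ↦ h t.1 := by
          rw [Finset.map_univ_equiv]
      _ = ((Finset.univ : Finset ↥(hfin i.1).toFinset).map
            (Function.Embedding.subtype _)).val.map h := by
          rw [Finset.map_val, Multiset.map_map]; rfl
      _ = ((hfin i.1).toFinset.val).map h := by
          rw [Finset.univ_eq_attach, Finset.attach_map_val]
  -- the sheet values are roots of `R`
  have hroot' : ∀ (t : T) (P : ComplexPoints X) (_ : q t = P) (hP : P.pt ∈ U),
      (R.map (P.evalRingHom U hP)).eval (h t) = 0 := by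
    rintro t _ rfl hP
    exact hroot t hP
  have hY : ∀ k i, (R.map (φ i)).eval (Y k i) = 0 := by
    intro k i
    have ht : (en i.1 k).1 ∈ q ⁻¹' {i.1} := (Set.Finite.mem_toFinset _).mp (en i.1 k).2
    exact hroot' _ i.1 ht i.2
  -- the coefficients of the fibrewise characteristic polynomial are regular
  let g : ℕ → ComplexPoints X → ℂ := fun j P ↦
    ((((hfin P).toFinset.val).map h).map fun a ↦ Polynomial.X - C a).prod.coeff j
  have key : ∀ j, ∃ b : Γ(X.left, U), ∀ (P : ComplexPoints X) (hP : P.pt ∈ U),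
      P.eval U hP b = g j P := by
    intro j
    obtain ⟨S, hS, hS0⟩ := exists_monic_eval_coeff_eq_zero φ Y R hR hY j
    refine CharPolyRegular.exists_eval_eq_of_continuousOn_of_root hU hUne hA S hS (g j)
      (continuousOn_coeff_charPoly hq hfin h hh j) fun P hP ↦ ?_
    have h1 := hS0 ⟨P, hP⟩
    rwa [hYM] at h1
  choose b hb using key
  have hb' : ∀ j (i : ι), φ i (b j) =
      (((Finset.univ : Finset (Fin d)).val.map fun k ↦ Y k i).map
        fun a ↦ Polynomial.X - C a).prod.coeff j := by
    intro j i
    rw [hYM]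
    exact hb j i.1 i.2
  obtain ⟨Q, hQm, hQ⟩ := exists_monic_map_eq_prod φ hφ Y b hb'
  refine ⟨Q, hQm, fun P hP ↦ ?_⟩
  have h1 := hQ ⟨P, hP⟩
  rw [hYM] at h1
  change (Q.map (φ ⟨P, hP⟩)).roots = _
  rw [h1, roots_multiset_prod_X_sub_C]

end Main

end CharPolyIntegral

end Literature.AlgebraicGeometry.FundamentalGroup

end
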